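import Literature.AlgebraicTopology.CharacteristicClasses.ProjectiveSpaceLerayHirsch
import Literature.AlgebraicTopology.SingularHomology.LerayHirschUnion
import HarnessLib

/-!
# Leray–Hirsch for a trivialised `ℙ(V)`-bundle: the hereditary local input from ONE trivialisation

D. Husemoller, *Fibre Bundles* (3rd ed. 1994), Ch. 17 §1 Thm. 1.1 and §2 Thm. 2.5 (proof: "restricted
to each fibre the classes `1, a, …, aⁿ⁻¹` generate its cohomology", read over a trivialising open
set); A. Hatcher, *Algebraic Topology* (2002), Thm. 4D.1. For a map `p : E → B`, classes
`cⱼ ∈ H²ʲ(E; ℂ)` (`j ≤ r`; in the applications the powers `ζʲ` of ONE degree-`2` class, e.g. the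
hyperplane class of a projective embedding of the total space of an algebraic `ℙʳ`-bundle, which is
NOT globally of the form `pr₂^* x`) and an open `P ⊆ B` with a trivialisation `T : p⁻¹P ≃ P × ℙ(V)`
over `P` carrying `cⱼ|p⁻¹P` to `cʲ • pr₂^* xʲ` for a NON-ZERO scalar `c` (`x = e(γ¹(V))` the
tautological class), the comparison map of `p⁻¹W → W` with the classes `cⱼ|` is bijective for
EVERY open `W ⊆ P` (`isLH_of_trivialisation`) — the hereditary local hypothesis of the tree's
local-to-global theorem `LerayHirsch.bijective_of_cover`. Ingredients: the product case
(`projectiveSpace_lerayHirsch`: `H*(W × ℙ(V))` is free over `H*(W)` on the `pr₂^* xʲ`), rescaling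
the classes by units (`bijective_lhMap_smul_iff`), restriction of a trivialisation with the formula
for its inverse (`exists_trivRestrict`). Also: over a `P` with `H⁰(P) = ℂ · 1` and `H²(P) = 0`
every degree-`2` class of `P × ℙ(V)` is `c • pr₂^* x` (`exists_eq_smul_map_snd_tautEuler`, the
degree-`2` case of the product theorem), `(c • y)ʲ = cʲ • yʲ` (`cupPow_smul`), and `q^*` is
one-to-one when the comparison map with `1, ζ, …, ζʳ` is bijective
(`injective_map_of_bijective_lhMap`). Everything is proved; no definitions, no named facts.

## References

* D. Husemoller, *Fibre Bundles*, GTM 20, Springer 1994, Ch. 17 §1 Thm. 1.1, §2 Thm. 2.3, Thm. 2.5. [HusemollerFibreBundles1994]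
* A. Hatcher, *Algebraic Topology*, CUP 2002, §3.2 Thm. 3.16, §4.D Thm. 4D.1. [HatcherAT2002]
-/

noncomputable section

open CategoryTheory Function Set Literature.AlgebraicTopology.SingularHomology
  Literature.AlgebraicTopology.SingularHomology.LerayHirsch
open scoped LinearAlgebra.Projectivization Topology

namespace Literature.AlgebraicTopology.CharacteristicClasses

/-! ### Cup powers of a rescaled class -/

/-- `(c • y)ʲ = cʲ • yʲ` for a degree-`2` class `y` (bilinearity of the cup product).
[cite: HatcherAT2002, §3.2 p. 212] -/
theorem cupPow_smul {Y : Type} [TopologicalSpace Y] (c : ℂ) (y : singularCohomology ℂ ℂ Y 2) :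
    ∀ j : ℕ, cupPow ℂ (c • y) j = c ^ j • cupPow ℂ y j
  | 0 => by rw [pow_zero, one_smul]; rfl
  | j + 1 => by
    rw [cupPow_succ, cupPow_succ, cupPow_smul c y j, LinearMap.map_smul₂, LinearMap.map_smul,
      smul_smul, pow_succ]

/-! ### Rescaling the Leray–Hirsch classes by non-zero scalars -/

section Rescale

variable {ι : Type} [Fintype ι] (d : ι → ℕ) {X' B' : Type} [TopologicalSpace X'] [TopologicalSpace B']

/-- **Rescaling the classes `cⱼ` by non-zero scalars `uⱼ` does not change the bijectivity of the
Leray–Hirsch comparison map**: `θ_{u • c} = θ_c ∘ D` with `D(a)ⱼ = uⱼ • aⱼ` a linear automorphism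
of the source. [cite: HusemollerFibreBundles1994, Ch. 17 §1 Thm. 1.1 (proof)] -/
theorem bijective_lhMap_smul_iff (q : C(X', B')) (c : (j : ι) → singularCohomology ℂ ℂ X' (d j))
    (u : ι → ℂ) (hu : ∀ j, u j ≠ 0) (k : ℕ) :
    Bijective (lhMap ℂ d q (fun j ↦ u j • c j) k) ↔ Bijective (lhMap ℂ d q c k) := by
  let D : Src ℂ d B' k ≃ₗ[ℂ] Src ℂ d B' k :=
    LinearEquiv.piCongrRight fun j ↦ LinearEquiv.smulOfNeZero ℂ _ (u j.1) (hu j.1)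
  have hD : ∀ a, lhMap ℂ d q (fun j ↦ u j • c j) k a = lhMap ℂ d q c k (D a) := by
    intro a
    rw [lhMap_apply, lhMap_apply]
    refine Finset.sum_congr rfl fun j _ ↦ ?_
    split_ifs with h
    · have hDa : D a ⟨j, h⟩ = u j • a ⟨j, h⟩ := rfl
      rw [hDa, map_smul, map_smul, LinearMap.map_smul₂]
    · rfl
  have hcomp : (lhMap ℂ d q (fun j ↦ u j • c j) k : Src ℂ d B' k → singularCohomology ℂ ℂ X' k) =
      lhMap ℂ d q c k ∘ D := funext hD
  rw [hcomp]
  exact Function.Bijective.of_comp_iff _ D.bijective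

/-- **The local model**: on `W × ℙ(V)` the comparison map with the rescaled classes
`cʲ • pr₂^* xʲ` (`c ≠ 0`) is bijective, granted `LH(V, N)` (the tree's `projectiveSpace_lerayHirsch`).
[cite: HusemollerFibreBundles1994, Ch. 17 §2 Thm. 2.5] [cite: HatcherAT2002, §3.2 Thm. 3.16] -/
theorem bijective_lhMap_smul_projCls (V : Type) [NormedAddCommGroup V] [NormedSpace ℂ V]
    [FiniteDimensional ℂ V] {N : ℕ} (hV : IsProjLH ℂ V N) {c : ℂ} (hc : c ≠ 0) (W : Type)
    [TopologicalSpace W] (k : ℕ) :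
    Bijective (lhMap ℂ (evenDeg N) (ContinuousMap.fst : C(W × ℙ ℂ V, W))
      (fun j ↦ c ^ (j : ℕ) • projCls ℂ V W N j) k) :=
  (bijective_lhMap_smul_iff (evenDeg N) ContinuousMap.fst (projCls ℂ V W N) (fun j ↦ c ^ (j : ℕ))
    (fun _ ↦ pow_ne_zero _ hc) k).2 (hV W k)

/-- **`q^*` is one-to-one when the comparison map with the classes `ζ⁰ = 1, ζ, …, ζʳ` is
bijective** (the `j = 0` component of `θ`; the argument of the tree's
`ComplexVectorBundle.map_projMap_injective`). [cite: HusemollerFibreBundles1994, Ch. 17 §2 Thm. 2.5] -/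
theorem injective_map_of_bijective_lhMap (pm : C(X', B')) {r : ℕ} (ζ : singularCohomology ℂ ℂ X' 2) (k : ℕ)
    (h : Bijective (lhMap ℂ (evenDeg (r + 1)) pm (fun j ↦ cupPow ℂ ζ j) k)) :
    Injective (singularCohomology.map ℂ ℂ pm k) := by
  have hrank : 0 < r + 1 := Nat.succ_pos r
  intro a a' haa
  -- embed `a` as the source with only the `j = 0` component
  let ι₀ : singularCohomology ℂ ℂ B' k → Src ℂ (evenDeg (r + 1)) B' k := fun x j ↦
    if hj : (j.1 : ℕ) = 0 then (by
      have e : k - evenDeg (r + 1) j.1 = k := by change k - 2 * (j.1 : ℕ) = k; rw [hj]; simp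
      exact degCast ℂ e.symm x) else 0
  have hθ : ∀ x, lhMap ℂ (evenDeg (r + 1)) pm (fun j ↦ cupPow ℂ ζ j) k (ι₀ x) =
      singularCohomology.map ℂ ℂ pm k x := by
    intro x
    rw [lhMap_apply, Finset.sum_eq_single (⟨0, hrank⟩ : Fin (r + 1))]
    · rw [dif_pos (show evenDeg (r + 1) ⟨0, hrank⟩ ≤ k from Nat.zero_le _)]
      change cupProduct _ (singularCohomology.map ℂ ℂ pm (k - 2 * 0) (ι₀ x ⟨⟨0, hrank⟩, _⟩)) (cupPow ℂ ζ 0) = _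
      have h0 : ι₀ x ⟨⟨0, hrank⟩, Nat.zero_le _⟩ = degCast ℂ (show k = k - 2 * 0 by simp) x := by
        change dite _ _ _ = _
        rw [dif_pos rfl]
      rw [h0, map_degCast, cupPow_zero, cupProduct_degCast_left ℂ _ _ (Nat.add_zero k), cupProduct_one]
    · intro j _ hj
      have hj0 : (j : ℕ) ≠ 0 := fun h0 ↦ hj (Fin.ext h0)
      split_ifs with h
      · have : ι₀ x ⟨j, h⟩ = 0 := by change dite _ _ _ = _; rw [dif_neg hj0]
        rw [this, map_zero, LinearMap.map_zero₂]
      · rfl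
    · intro h; exact absurd (Finset.mem_univ _) h
  have : ι₀ a = ι₀ a' := h.1 (by rw [hθ, hθ, haa])
  have h0 := congrFun this ⟨⟨0, hrank⟩, Nat.zero_le _⟩
  change dite _ _ _ = dite _ _ _ at h0
  rw [dif_pos rfl, dif_pos rfl] at h0
  exact (degCast ℂ _).injective h0

end Rescale

/-! ### Restricting a trivialisation over a smaller subset of the base -/

section Restrict

variable {X B F : Type} [TopologicalSpace X] [TopologicalSpace B] [TopologicalSpace F]
  (p : C(X, B)) {U W : Set B} (hWU : W ⊆ U) (φ : ↥(p ⁻¹' U) ≃ₜ ↥U × F)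
  (hφ : ∀ x, ((φ x).1 : B) = p x)

include hφ in
/-- The inverse of a trivialisation over `U` lands over the right point. [folklore] -/
theorem apply_symm_fst (y : ↥U × F) : p (φ.symm y).1 = y.1 := by
  have h := hφ (φ.symm y)
  rw [φ.apply_symm_apply] at h
  exact h.symm

include hWU hφ in
/-- **Restriction of a trivialisation** `p⁻¹U ≃ U × F` over `U` to `p⁻¹W ≃ W × F` over `W ⊆ U`,
whose inverse is the restriction of the inverse (the construction of the tree's
`exists_trivialisation_restrict`, with the formula for the inverse recorded).
[cite: HusemollerFibreBundles1994, Ch. 2 §4] -/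
theorem exists_trivRestrict : ∃ ψ : ↥(p ⁻¹' W) ≃ₜ ↥W × F, (∀ x, ((ψ x).1 : B) = p x) ∧
    ∀ y : ↥W × F, (ψ.symm y : X) = (φ.symm (⟨y.1, hWU y.1.2⟩, y.2) : X) := by
  have hmem : ∀ y : ↥W × F, (φ.symm (⟨y.1.1, hWU y.1.2⟩, y.2)).1 ∈ p ⁻¹' W := fun y ↦ by
    change p _ ∈ W
    rw [apply_symm_fst p φ hφ]
    exact y.1.2
  refine ⟨{ toFun := fun x ↦ (⟨p x.1, x.2⟩, (φ ⟨x.1, hWU x.2⟩).2)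
            invFun := fun y ↦ ⟨(φ.symm (⟨y.1.1, hWU y.1.2⟩, y.2)).1, hmem y⟩
            left_inv := fun x ↦ by
              apply Subtype.ext
              have h1 : (⟨p x.1, hWU x.2⟩, (φ ⟨x.1, hWU x.2⟩).2) = φ ⟨x.1, hWU x.2⟩ :=
                Prod.ext (Subtype.ext (hφ ⟨x.1, hWU x.2⟩).symm) rfl
              change (φ.symm (⟨p x.1, hWU x.2⟩, (φ ⟨x.1, hWU x.2⟩).2)).1 = x.1
              rw [h1, φ.symm_apply_apply]
            right_inv := fun y ↦ by
              refine Prod.ext (Subtype.ext (apply_symm_fst p φ hφ _)) ?_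
              change (φ ⟨(φ.symm (⟨y.1.1, hWU y.1.2⟩, y.2)).1, _⟩).2 = y.2
              rw [Subtype.coe_eta, φ.apply_symm_apply]
            continuous_toFun := by
              refine Continuous.prodMk ?_ ?_
              · exact (p.continuous.comp continuous_subtype_val).subtype_mk _
              · exact continuous_snd.comp (φ.continuous.comp (continuous_subtype_val.subtype_mk _))
            continuous_invFun :=
              (continuous_subtype_val.comp (φ.symm.continuous.comp
                (((continuous_subtype_val.comp continuous_fst).subtype_mk fun y ↦ hWU y.1.2).prodMk
                  continuous_snd))).subtype_mk _ }, fun _ ↦ rfl, fun _ ↦ rfl⟩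

end Restrict

/-! ### The hereditary local Leray–Hirsch input from ONE trivialisation -/

section Local

variable {Et B : Type} [TopologicalSpace Et] [TopologicalSpace B] (pm : C(Et, B))
  (V : Type) [NormedAddCommGroup V] [NormedSpace ℂ V] [FiniteDimensional ℂ V] {r : ℕ}

/-- **The local input of Leray–Hirsch for a trivialised `ℙ(V)`-bundle.** Let `p : E → B`, classes
`cⱼ ∈ H²ʲ(E)` (`j ≤ r`), an open `P ⊆ B` with a trivialisation `T : p⁻¹P ≃ P × ℙ(V)` over `P`
carrying `cⱼ|p⁻¹P` to `cʲ • pr₂^* xʲ` for a scalar `c ≠ 0`, and `LH(V, r + 1)`. Then for every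
`W ⊆ P` the comparison map of `p⁻¹W → W` with the classes `cⱼ|` is bijective in all degrees
(restrict `T` over `W`, transport along the homeomorphism, rescale the product case).
[cite: HusemollerFibreBundles1994, Ch. 17 §1 Thm. 1.1 and §2 Thm. 2.5 (proof)] -/
theorem isLH_of_trivialisation (hV : IsProjLH ℂ V (r + 1))
    (cls : (j : Fin (r + 1)) → singularCohomology ℂ ℂ Et (evenDeg (r + 1) j))
    {P : Set B} (T : ↥(pm ⁻¹' P) ≃ₜ ↥P × ℙ ℂ V) (hT : ∀ x, ((T x).1 : B) = pm x) {c : ℂ} (hc : c ≠ 0)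
    (hcls : ∀ j, singularCohomology.map ℂ ℂ (T.symm : C(↥P × ℙ ℂ V, ↥(pm ⁻¹' P))) (evenDeg (r + 1) j)
      (resCls pm P cls j) = c ^ (j : ℕ) • projCls ℂ V ↥P (r + 1) j)
    {W : Set B} (hWP : W ⊆ P) : IsLH ℂ (evenDeg (r + 1)) pm cls W := by
  obtain ⟨TW, -, hTW⟩ := exists_trivRestrict pm hWP T hT
  refine (bijective_iff_of_homeomorph ℂ (evenDeg (r + 1)) (resMap pm W)
    (ContinuousMap.fst : C(↥W × ℙ ℂ V, ↥W)) TW.symm (Homeomorph.refl ↥W) ?_ (resCls pm W cls)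
    (fun j ↦ c ^ (j : ℕ) • projCls ℂ V ↥W (r + 1) j) ?_).2 (bijective_lhMap_smul_projCls V hV hc ↥W)
  · ext1 y
    apply Subtype.ext
    change pm ((TW.symm y) : Et) = (y.1 : B)
    rw [hTW]
    exact apply_symm_fst pm T hT _
  · intro j
    let i : C(↥W × ℙ ℂ V, ↥P × ℙ ℂ V) :=
      ⟨fun y ↦ (⟨y.1, hWP y.1.2⟩, y.2),
        ((continuous_subtype_val.comp continuous_fst).subtype_mk fun y ↦ hWP y.1.2).prodMk continuous_snd⟩
    have hsq : (subsetIncl (pm ⁻¹' W)).comp (TW.symm : C(↥W × ℙ ℂ V, ↥(pm ⁻¹' W))) =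
        ((subsetIncl (pm ⁻¹' P)).comp (T.symm : C(↥P × ℙ ℂ V, ↥(pm ⁻¹' P)))).comp i := by
      ext1 y
      exact hTW y
    have h1 : singularCohomology.map ℂ ℂ (TW.symm : C(↥W × ℙ ℂ V, ↥(pm ⁻¹' W))) (evenDeg (r + 1) j)
        (resCls pm W cls j) = singularCohomology.map ℂ ℂ i (evenDeg (r + 1) j)
          (singularCohomology.map ℂ ℂ (T.symm : C(↥P × ℙ ℂ V, ↥(pm ⁻¹' P))) (evenDeg (r + 1) j)
            (resCls pm P cls j)) := by
      change singularCohomology.map ℂ ℂ _ _ (singularCohomology.map ℂ ℂ _ _ (cls j)) =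
        singularCohomology.map ℂ ℂ _ _ (singularCohomology.map ℂ ℂ _ _ (singularCohomology.map ℂ ℂ _ _ (cls j)))
      rw [← ModuleCat.comp_apply, ← singularCohomology.map_comp, hsq, singularCohomology.map_comp,
        singularCohomology.map_comp, ModuleCat.comp_apply, ModuleCat.comp_apply]
    rw [h1, hcls j, map_smul]
    congr 1
    change singularCohomology.map ℂ ℂ i _ (singularCohomology.map ℂ ℂ ContinuousMap.snd _ (xpow ℂ V j)) =
      singularCohomology.map ℂ ℂ ContinuousMap.snd _ (xpow ℂ V j)
    rw [← ModuleCat.comp_apply, ← singularCohomology.map_comp]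
    rfl

end Local

/-! ### Degree-two classes on `P × ℙ(V)` for `P` path connected with `H²(P) = 0` -/

section DegreeTwo

variable (V : Type) [NormedAddCommGroup V] [NormedSpace ℂ V] [FiniteDimensional ℂ V] {r : ℕ}

/-- `x¹ = x` for the powers of the tautological class. [folklore] -/
theorem xpow_one : xpow ℂ V 1 = tautEuler V ℂ 1 := by
  rw [xpow, cupPow_succ, cupPow_zero]
  exact one_cupProduct _

/-- **Degree-`2` classes of `P × ℙ(V)` are `c • pr₂^* x`** when `H⁰(P; ℂ) = ℂ · 1` (e.g. `P` path
connected), `H²(P; ℂ) = 0` and `dim V = r + 1 ≥ 2` (the degree-`2` case of the product Leray–Hirsch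
theorem: `H²(P × ℙ(V)) = pr₁^* H²(P) ⊕ pr₁^* H⁰(P) ⌣ pr₂^* x`). [cite: HatcherAT2002, §3.2 Thm. 3.16]
[cite: HusemollerFibreBundles1994, Ch. 17 §2 Thm. 2.5] -/
theorem exists_eq_smul_map_snd_tautEuler (hV : IsProjLH ℂ V (r + 1)) (hr : 1 ≤ r) (P : Type)
    [TopologicalSpace P] (hP0 : ∀ z : singularCohomology ℂ ℂ P 0, ∃ c : ℂ, z = c • singularCohomology.one ℂ P)
    (hP : Subsingleton (singularCohomology ℂ ℂ P 2)) (y : singularCohomology ℂ ℂ (P × ℙ ℂ V) 2) :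
    ∃ c : ℂ, y = c • singularCohomology.map ℂ ℂ (ContinuousMap.snd : C(P × ℙ ℂ V, ℙ ℂ V)) 2 (tautEuler V ℂ 1) := by
  obtain ⟨a, rfl⟩ := (hV P 2).2 y
  have h1 : 1 < r + 1 := by omega
  have hj₁ : evenDeg (r + 1) ⟨1, h1⟩ ≤ 2 := by change 2 * 1 ≤ 2; omega
  set a₁ : singularCohomology ℂ ℂ P 0 := a ⟨⟨1, h1⟩, hj₁⟩ with ha₁def
  obtain ⟨ε, ha⟩ := hP0 a₁
  refine ⟨ε, ?_⟩
  rw [lhMap_apply, Finset.sum_eq_single ⟨1, h1⟩]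
  · rw [dif_pos hj₁]
    have hpc : projCls ℂ V P (r + 1) ⟨1, h1⟩ =
        singularCohomology.map ℂ ℂ (ContinuousMap.snd : C(P × ℙ ℂ V, ℙ ℂ V)) 2 (tautEuler V ℂ 1) := by
      change singularCohomology.map ℂ ℂ ContinuousMap.snd 2 (xpow ℂ V 1) = _
      rw [xpow_one]
    have key : cupProduct (Nat.zero_add 2)
        (singularCohomology.map ℂ ℂ (ContinuousMap.fst : C(P × ℙ ℂ V, P)) 0 a₁)
        (singularCohomology.map ℂ ℂ (ContinuousMap.snd : C(P × ℙ ℂ V, ℙ ℂ V)) 2 (tautEuler V ℂ 1)) =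
        ε • singularCohomology.map ℂ ℂ (ContinuousMap.snd : C(P × ℙ ℂ V, ℙ ℂ V)) 2 (tautEuler V ℂ 1) := by
      rw [ha, map_smul, singularCohomology.map_one, LinearMap.map_smul₂, one_cupProduct]
    rw [hpc]
    exact key
  · rintro ⟨b, hb⟩ - hne
    rcases b with _ | _ | b
    · have h0 : evenDeg (r + 1) ⟨0, hb⟩ ≤ 2 := by change 2 * 0 ≤ 2; omega
      rw [dif_pos h0]
      haveI : Subsingleton (singularCohomology ℂ ℂ P (2 - evenDeg (r + 1) ⟨0, hb⟩)) := hP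
      rw [Subsingleton.elim (a ⟨⟨0, hb⟩, h0⟩) 0, map_zero, LinearMap.map_zero₂]
    · exact absurd rfl hne
    · rw [dif_neg]
      change ¬(2 * (b + 2) ≤ 2)
      omega
  · intro h
    exact absurd (Finset.mem_univ _) h

end DegreeTwo

end Literature.AlgebraicTopology.CharacteristicClasses

end
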